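import Summits.AtomisticToContinuum.FouriersLaw.Theorems.JunctionLocalityNonBallisticOfWindow

/-! Probe: does the landed theorem `nonBallistic_of_subballisticTransitWindow` have (definitionally) the type
`Child1 → Child2 → JunctionLocality.NonBallistic` for the two children texts as they will be filed? -/

namespace Summit.AtomisticToContinuum.FouriersLaw.Theses.JunctionLocality

open scoped BigOperators Topology Manifold Classical MeasureTheory ProbabilityTheory Matrix InnerProductSpace ComplexConjugate ContinuousMap
open Filter Set Function TopologicalSpace MeasureTheory

def ExtensiveSnapshotIrreversibilityChild : Prop :=
  ∀ ω₂ lam β γ : ℝ, 0 < ω₂ → 0 < lam → 0 < β → 0 < γ → (∀ (N : ℕ) (T_L T_R : ℝ), 0 < T_L → 0 < T_R → ∀ μ ν : MeasureTheory.Measure (Literature.MathematicalPhysics.KineticTheory.HeatConduction.PhaseSpace N), (Literature.MathematicalPhysics.KineticTheory.HeatConduction.pinnedChain ω₂ lam β γ).IsSteadyState N T_L T_R μ → (Literature.MathematicalPhysics.KineticTheory.HeatConduction.pinnedChain ω₂ lam β γ).IsSteadyState N T_L T_R ν → μ = ν) → ∀ μ : (N : ℕ) → ℝ → ℝ → MeasureTheory.Measure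 (Literature.MathematicalPhysics.KineticTheory.HeatConduction.PhaseSpace N), (∀ (N : ℕ) (T_L T_R : ℝ), 0 < T_L → 0 < T_R → (Literature.MathematicalPhysics.KineticTheory.HeatConduction.pinnedChain ω₂ lam β γ).IsSteadyState N T_L T_R (μ N T_L T_R)) → ∀ T : ℝ, 0 < T → ∃ C : ℝ, ∀ N : ℕ, ∀ᶠ δ in nhdsWithin (0 : ℝ) {(0 : ℝ)}ᶜ, InformationTheory.klDiv (μ N (T + δ / 2) (T - δ / 2)) (MeasureTheory.Measure.map (fun x : Literature.MathematicalPhysics.KineticTheory.HeatConduction.PhaseSpace N => (x.1, -x.2)) (μ N (T + δ / 2) (T - δ / 2))) ≤ ENNReal.ofReal (C * (N : ℝ) * δ ^ 2)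

def SubballisticTransitWindowChild : Prop :=
  ∀ ω₂ lam β γ : ℝ, 0 < ω₂ → 0 < lam → 0 < β → 0 < γ → ∀ T : ℝ, 0 < T → ∀ C : ℕ → ℝ → ℝ, C = (fun (N : ℕ) (s : ℝ) => ∫ x, (∑ i : Fin N, (Literature.MathematicalPhysics.KineticTheory.HeatConduction.pinnedChain ω₂ lam β γ).bondCurrent N i x) * (∫ y, (∑ i : Fin N, (Literature.MathematicalPhysics.KineticTheory.HeatConduction.pinnedChain ω₂ lam β γ).bondCurrent N i y) ∂((Literature.MathematicalPhysics.KineticTheory.HeatConduction.pinnedChain ω₂ lam β γ).transitionKernel N T T s.toNNReal x)) ∂((Literature.MathematicalPhysics.KineticTheory.HeatConduction.pinnedChain ω₂ lam β γ).gibbsMeasure N T)) → ∃ a : ℝ, 0 < a ∧ ∀ ε : ℝ, 0 < ε → ∃ N₀ : ℕ, ∀ N : ℕ, N₀ ≤ N → ∃ τ : ℝ, 0 < τ ∧ τ ≤ a * (N : ℝ) ∧ (2 * ∫ s in (0 : ℝ)..τ, (τ - s) * C N s) ≤ ε * (N : ℝ) * τ ^ 2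

/-- the `--glue-by` shape check, by term (no tactic): -/
theorem splitGlueProbe : ExtensiveSnapshotIrreversibilityChild → SubballisticTransitWindowChild → NonBallistic :=
  _root_.Summit.AtomisticToContinuum.FouriersLaw.Theorems.NonBallistic.nonBallistic_of_subballisticTransitWindow

example : SubballisticTransitWindowChild ↔
    _root_.Summit.AtomisticToContinuum.FouriersLaw.Theorems.NonBallistic.DrudeLine.SubballisticTransitWindow := Iff.rfl

example : ExtensiveSnapshotIrreversibilityChild ↔
    _root_.Summit.AtomisticToContinuum.FouriersLaw.Theses.BondHeatUncertainty.ExtensiveSnapshotIrreversibility := Iff.rfl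

end Summit.AtomisticToContinuum.FouriersLaw.Theses.JunctionLocality
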